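import Mathlib
import HarnessLib
import Summits.ResolutionOfSingularities.ResolutionOfSingularities.Theorems.EquisingularLiftDefs

/-!
# `EquisingularLift` — the STRATA split of the crux, assembly PROVED

Crux `stmt-ResolutionOfSingularities-15660` = `Theses.EquisingularLift.EquisingularLift` (EL). The crux-strategist seat
`planner-cstrat-stmt-ResolutionOfSingularities-15660-r1-0` (2026-08-17) cut EL along the STRATA seam into the two typed
children `Split.LiftableIsolation` / `Split.IsolatedPointDrop` (statements: `Theorems/EquisingularLiftDefs.lean`) and
PROVED the assembly; this file is the strategist's `Cruxes/EquisingularLift/StrategySplit.lean` (proof part, verbatim),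
landed by the line lead of line `strata-split`.

* `Split.Chain.fibre` — along a chain starting from `Y = closure {ξ}` the fibre over `ξ` stays ONE point `ξ'` and the
  iterated strict transform is `closure {ξ'}` (each blow-up is an isomorphism off its centre, GW I Prop. 13.91 (3) =
  `IsBlowup.isIso_morphismRestrict`, and the centre misses the point over `ξ`).
* `Split.Chain.comp` — a chain over `(P, Y)` followed by a chain over `(P₁, closure S₁)` is a chain over `(P, Y)`.
* `Split.equisingularLift_of_subs : LiftableIsolation → IsolatedPointDrop → EquisingularLift` — strong induction on
  the number of non-regular points of the reduced strict transform, carrying chain / irreducibility / finiteness /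
  good reduction. Once the split of `Cruxes/EquisingularLift/SPLIT.md` is applied to the route, the generated glue item
  closes by `fun h₁ h₂ => Split.equisingularLift_of_subs h₁ h₂` (the route decls unfold to the `Split` statements).

Three folklore lemmas on morphisms that are isomorphisms over an open are inlined (`existsUnique_preimage`,
`isOpen_image`, `preimage_closure_inter_subset`) because `Literature…EmbeddedResolution`'s import cone is not
route-clean.
-/

set_option linter.dupNamespace false -- mandated namespace `Summit.<Summit>.<Problem>` of this single-conjunct summit

open CategoryTheory AlgebraicGeometry TopologicalSpace Topology
open Literature.AlgebraicGeometry.Resolution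

namespace Summit.ResolutionOfSingularities.ResolutionOfSingularities.Theses.EquisingularLift

namespace Split

/-! ## Generic fibre of a chain: the point over the generic point is unique at every stage -/

/-- If `g` is an isomorphism over the open `W`, every point of `W` has exactly one preimage.
[folklore; inlined from `Literature…EmbeddedResolution`, whose import cone is not route-clean] -/
theorem existsUnique_preimage {A B : Scheme.{0}} (g : A ⟶ B) {W : B.Opens} (hW : IsIso (g ∣_ W))
    {y : B} (hy : y ∈ W) : ∃! x : A, g x = y := by
  let eW := Scheme.homeoOfIso (asIso (g ∣_ W))
  have he : ∀ z : ↥((Opens.map g.base).obj W), (eW z).1 = g z.1 := fun z =>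
    morphismRestrict_base_coe g W z
  let y' : ↥(W : Scheme.{0}) := ⟨y, hy⟩
  refine ⟨(eW.symm y').1,
    (he _).symm.trans (congrArg Subtype.val (eW.apply_symm_apply y')), ?_⟩
  intro x (hx : g x = y)
  have hxW : x ∈ (Opens.map g.base).obj W := show g x ∈ W by rw [hx]; exact hy
  have hex : eW ⟨x, hxW⟩ = y' := Subtype.ext ((he _).trans hx)
  exact (congrArg Subtype.val (eW.symm_apply_apply ⟨x, hxW⟩)).symm.trans
    (congrArg (fun w => (eW.symm w).1) hex)

/-- If `g` is an isomorphism over the open `W`, images of open subsets of `g ⁻¹ W` are open. [folklore] -/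
theorem isOpen_image {A B : Scheme.{0}} (g : A ⟶ B) {W : B.Opens} (hW : IsIso (g ∣_ W))
    {S : Set A} (hS : IsOpen S) (hSW : S ⊆ ((Opens.map g.base).obj W : Set A)) : IsOpen (g '' S) := by
  let eW := Scheme.homeoOfIso (asIso (g ∣_ W))
  have he : ∀ z : ↥((Opens.map g.base).obj W), (eW z).1 = g z.1 := fun z =>
    morphismRestrict_base_coe g W z
  have himg : g '' S = W.ι '' (eW '' (Scheme.Opens.ι ((Opens.map g.base).obj W) ⁻¹' S)) := by
    ext y
    constructor
    · rintro ⟨x, hx, rfl⟩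
      exact ⟨eW ⟨x, hSW hx⟩, ⟨⟨x, hSW hx⟩, hx, rfl⟩, he _⟩
    · rintro ⟨_, ⟨z, hz, rfl⟩, rfl⟩
      exact ⟨z.1, hz, (he z).symm⟩
  rw [himg]
  exact W.ι.isOpenEmbedding.isOpenMap _
    (eW.isOpenMap _ (hS.preimage (Scheme.Opens.ι ((Opens.map g.base).obj W)).continuous))

/-- If `g` is an isomorphism over the open `W` and `B' ⊆ B`, every point of `g ⁻¹ W` over the closure
of `B'` lies in the closure of `g ⁻¹ B'`. [folklore] -/
theorem preimage_closure_inter_subset {A B : Scheme.{0}} (g : A ⟶ B) {W : B.Opens}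
    (hW : IsIso (g ∣_ W)) (B' : Set B) :
    g ⁻¹' closure B' ∩ ((Opens.map g.base).obj W : Set A) ⊆ closure (g ⁻¹' B') := by
  rintro x ⟨hxB, hxW⟩
  rw [mem_closure_iff]
  intro S hS hxS
  have hS' : IsOpen (g '' (S ∩ ((Opens.map g.base).obj W : Set A))) :=
    isOpen_image g hW (hS.inter ((Opens.map g.base).obj W).isOpen) Set.inter_subset_right
  obtain ⟨_, ⟨o, ⟨hoS, -⟩, rfl⟩, hoB⟩ := mem_closure_iff.mp hxB _ hS' ⟨x, ⟨hxS, hxW⟩, rfl⟩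
  exact ⟨o, hoS, hoB⟩

/-- STRUCTURE LEMMA. Along a chain starting from `Y = closure {ξ}`, the fibre over `ξ` stays a single
point `ξ'` and the iterated strict transform is `closure {ξ'}` (no properness needed: each blow-up is
an isomorphism off its centre, and the centre misses the point over `ξ`). -/
theorem Chain.fibre {P : Scheme.{0}} {Y : Set P} {P' : Scheme.{0}} {σ : P' ⟶ P} {S' : Set P'}
    (h : Chain P Y P' σ S') {ξ : P} (hξ : IsGenericPoint ξ Y) :
    ∃ ξ' : P', σ ⁻¹' {ξ} = {ξ'} ∧ S' = closure {ξ'} := by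
  refine h (fun X' σ' Y' => ∃ ξ' : X', σ' ⁻¹' {ξ} = {ξ'} ∧ Y' = closure {ξ'}) ?_ ?_
  · refine ⟨ξ, ?_, hξ.symm⟩
    ext x
    simp
  · intro X' X'' σ' Y' C τ hQ hτ _ hTC
    obtain ⟨ξ', hfib, hY'⟩ := hQ
    have hξ'σ : σ' ξ' = ξ := by
      have : ξ' ∈ σ' ⁻¹' {ξ} := by rw [hfib]; exact rfl
      simpa using this
    have hξ'C : ξ' ∉ (C.support : Set X') := by
      intro h'
      have := hTC ⟨ξ', h', hξ'σ⟩
      exact this hξ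
    let Wc : X'.Opens := ⟨(C.support : Set X')ᶜ, C.support.isClosed.isOpen_compl⟩
    have hWc : IsIso (τ ∣_ Wc) := hτ.isIso_morphismRestrict disjoint_compl_left
    obtain ⟨ξ₂, hξ₂, huniq⟩ := existsUnique_preimage τ hWc (y := ξ') hξ'C
    have hfibτ : τ ⁻¹' {ξ'} = {ξ₂} := by
      ext z
      simp only [Set.mem_preimage, Set.mem_singleton_iff]
      exact ⟨fun hz => huniq z hz, fun hz => hz ▸ hξ₂⟩
    refine ⟨ξ₂, ?_, ?_⟩
    · rw [show (CategoryStruct.comp τ σ') ⁻¹' {ξ} = τ ⁻¹' (σ' ⁻¹' {ξ}) from by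
        ext z; simp, hfib, hfibτ]
    · apply le_antisymm
      · refine closure_minimal ?_ isClosed_closure
        rintro x ⟨hxY, hxC⟩
        rw [hY'] at hxY
        have hx := preimage_closure_inter_subset τ hWc {ξ'} ⟨hxY, hxC⟩
        rwa [hfibτ] at hx
      · refine closure_mono (Set.singleton_subset_iff.mpr ⟨?_, ?_⟩)
        · rw [hY']
          show τ ξ₂ ∈ closure {ξ'}
          rw [hξ₂]
          exact subset_closure rfl
        · show τ ξ₂ ∉ (C.support : Set X')
          rw [hξ₂]
          exact hξ'C

/-- COMPOSITION LEMMA. A chain over `(P, Y)` followed by a chain over `(P₁, closure S₁)` is a chain over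
`(P, Y)`: a centre off the generic point of the strict transform `closure S₁ = closure {ξ₁}` is off the
generic point `ξ` of `Y`, because the fibre of `σ₁` over `ξ` is `{ξ₁}`. -/
theorem Chain.comp {P : Scheme.{0}} {Y : Set P} {ξ : P} (hξ : IsGenericPoint ξ Y)
    {P₁ : Scheme.{0}} {σ₁ : P₁ ⟶ P} {S₁ : Set P₁} (h₁ : Chain P Y P₁ σ₁ S₁)
    {P₂ : Scheme.{0}} {σ₂ : P₂ ⟶ P₁} {S₂ : Set P₂} (h₂ : Chain P₁ (closure S₁) P₂ σ₂ S₂) :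
    Chain P Y P₂ (CategoryStruct.comp σ₂ σ₁) S₂ := by
  obtain ⟨ξ₁, hfib, hS₁⟩ := h₁.fibre hξ
  have hS₁cl : closure S₁ = S₁ := by rw [hS₁, closure_closure]
  have hgen₁ : IsGenericPoint ξ₁ (closure S₁) := by
    rw [isGenericPoint_def, hS₁, closure_closure]
  intro Q hbase hstep
  have hQ₁ : Q P₁ σ₁ S₁ := h₁ Q hbase hstep
  refine h₂ (fun X' τ T => Q X' (CategoryStruct.comp τ σ₁) T) ?_ ?_
  · simpa [hS₁cl] using hQ₁
  · intro X' X'' τ T C τ' hQ hτ' hC hTC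
    have key : (CategoryStruct.comp τ σ₁) '' (C.support : Set X') ⊆ {x : P | ¬ IsGenericPoint x Y} := by
      rintro _ ⟨c, hc, rfl⟩ hgen
      have h1 : σ₁ (τ c) = ξ := by
        rw [← Scheme.Hom.comp_apply]
        exact hgen.eq hξ
      have h2 : τ c = ξ₁ := by
        have : τ c ∈ σ₁ ⁻¹' {ξ} := h1
        rw [hfib] at this
        simpa using this
      exact hTC ⟨c, hc, rfl⟩ (h2 ▸ hgen₁)
    have := hstep X' X'' (CategoryStruct.comp τ σ₁) T C τ' hQ hτ' hC key
    simpa [Category.assoc] using this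

/-! ## The assembly -/

/-- **ASSEMBLY (BC2 redirect)**: `LiftableIsolation → IsolatedPointDrop → EquisingularLift`. -/
theorem equisingularLift_of_subs : LiftableIsolation → IsolatedPointDrop → EquisingularLift := by
  classical
  intro hA hB p hp k _ _ _ n H ι hι hH hpr
  obtain ⟨O, i1, i2, i3, i4, i5, i6, P, P₁, q, Y, σ₁, S₁, hq, hqp, hY, ⟨e⟩, hch, hirr, hfin, hgood⟩ :=
    hA p hp k n H ι hι hH hpr
  haveI := hH
  -- the generic point of `Y` (image of the generic point of the integral `H ≅ V(Y)`)
  let ι₀ : H ⟶ P := CategoryStruct.comp e.inv (Scheme.IdealSheafData.vanishingIdeal Y).subschemeι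
  have hrange : Set.range ι₀ = (Y : Set P) := by
    rw [← Scheme.IdealSheafData.coe_support_vanishingIdeal Y,
      ← Scheme.IdealSheafData.range_subschemeι]
    ext x
    constructor
    · rintro ⟨h, rfl⟩
      exact ⟨e.inv h, (Scheme.Hom.comp_apply _ _ h).symm⟩
    · rintro ⟨y, rfl⟩
      obtain ⟨h, rfl⟩ := e.inv.surjective y
      exact ⟨h, Scheme.Hom.comp_apply _ _ h⟩
  have hgen : IsGenericPoint (ι₀ (genericPoint H)) (Y : Set P) := by
    have h := (genericPoint_spec H).image ι₀.continuous
    rwa [Set.image_univ, ι₀.isClosedEmbedding.isClosed_range.closure_eq, hrange] at h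
  have hYirr : IsIrreducible (Y : Set P) := by
    have h := (isIrreducible_singleton (x := ι₀ (genericPoint H))).closure
    rwa [hgen] at h
  -- strong induction on the number of non-regular points of the strict transform, carrying the chain, the
  -- irreducibility of the special fibre, finiteness and the good-reduction clause along
  suffices key : ∀ (m : ℕ) (P₁ : Scheme.{0}) (σ₁ : P₁ ⟶ P) (S₁ : Set P₁),
      Chain P (Y : Set P) P₁ σ₁ S₁ →
      IsIrreducible ((CategoryStruct.comp σ₁ q) ⁻¹' {IsLocalRing.closedPoint O}) →
      (singSet S₁).Finite → GoodSet (CategoryStruct.comp σ₁ q) S₁ → (singSet S₁).ncard = m →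
      ∃ (P' : Scheme.{0}) (σ : P' ⟶ P) (S' : Set P'), Chain P (Y : Set P) P' σ S' ∧
        IsIrreducible ((CategoryStruct.comp σ q) ⁻¹' {IsLocalRing.closedPoint O}) ∧
        Scheme.IsRegular (Scheme.IdealSheafData.vanishingIdeal
          (⟨closure S', isClosed_closure⟩ : Closeds P')).subscheme by
    obtain ⟨P', σ, S', h1, h2, h3⟩ := key _ P₁ σ₁ S₁ hch hirr hfin hgood rfl
    refine ⟨O, i1, i2, i3, i4, P, P', q, Y, σ, S', hq, hqp, hY, ⟨e⟩, ?_, h2, h3⟩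
    exact h1
  intro m
  induction m using Nat.strong_induction_on with
  | _ m ih =>
    intro P₁ σ₁ S₁ hch₁ hirr₁ hfin₁ hgood₁ hm
    by_cases hne : (singSet S₁).Nonempty
    · obtain ⟨P₂, σ₂, S₂, hch₂, hirr₂, hfin₂, hgood₂, hlt⟩ :=
        hB O P P₁ q Y σ₁ S₁ hq hqp hY hYirr hch₁ hirr₁ hfin₁ hgood₁ hne
      have hch' : Chain P (Y : Set P) P₂ (CategoryStruct.comp σ₂ σ₁) S₂ := hch₁.comp hgen hch₂
      have hlt' : (singSet S₂).ncard < m := by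
        rw [← hm]
        exact hlt
      exact ih _ hlt' P₂ (CategoryStruct.comp σ₂ σ₁) S₂ hch' hirr₂ hfin₂ hgood₂ rfl
    · refine ⟨P₁, σ₁, S₁, hch₁, hirr₁, fun x => ?_⟩
      by_contra hx
      exact hne ⟨x, hx⟩

end Split

end Summit.ResolutionOfSingularities.ResolutionOfSingularities.Theses.EquisingularLift
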